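import Summits.HodgeConjecture.HodgeConjecture.Theorems.PadicSemiregularLiftHodgeFermatVarietiesPairedOfLargePrimesNull
import Summits.HodgeConjecture.HodgeConjecture.Theorems.PadicSemiregularLiftHodgeFermatVarietiesPairedOfLargePrimesOrbit
import HarnessLib

/-!
# Short character-sum configurations, V: the boundary configuration (pieces and fibres)

Crux `HodgeFermatVarieties` (stmt-HodgeConjecture-1334), line `cancel-by-any-claim-lattice`, stub S6
`stub_pairedOfLargePrimes` (lead c2), boundary prime `p₀`. Level `N = p₀ · n` with `p₀ ∤ n`; a
configuration `T : ℤ/N → ℂ` supported on units, annihilated by every odd primitive character mod `N`,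
with room at the primes of `n` (`#supp T + 1 < p'`) but possibly none at `p₀`.

* transport of the rigidity lemmas of `FermatHodgeCharacterRigidity` to a level `N` with `q ∣ N`;
* `piece_annihilated` — ITERATED PAIR RESTRICTION: for a unit `x`, the restriction of `T` to the region
  `{z : z ≡ ±x (mod q') for every prime power q' ∥ n}` is again odd-annihilated (free elements by counting);
* `exists_sq_eq_one_of_region` — the region mod `n` is the sign orbit `x·{u : u² = 1}`;
* `fibre_const_of_piece` — FIBRE CONSTANCY at `p₀`: for such a piece, `y ↦ T(crt(y,b)) - T(-crt(y,b))`
  is constant on the units `y` mod `p₀` (`orbit_sign` at level `n` + the local Fourier lemma at `p₀`).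
Everything here is proved; no named facts. The dichotomy and the Hodge-level conclusion are part VI.

References: [Aoki1983] N. Aoki, Math. Ann. 266 (1983) 23–54, Prop. 6.4 and §9.
-/

set_option linter.dupNamespace false

noncomputable section

open Finset
open Literature.AlgebraicGeometry.HodgeTheory Literature.AlgebraicGeometry.HodgeTheory.FermatCharacter

namespace Summit.HodgeConjecture.HodgeConjecture.Theorems.CancelByAnyClaimLattice

namespace PairedNull

section Transport

variable {N q : ℕ} [NeZero N] [NeZero q]

/-- `annihilated_restrict_pair` at a level `N` with `q ∣ N`, `q` coprime to `N/q`. [cite: Aoki1983, Prop. 6.4] -/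
theorem restrict_pair_of_dvd (hqN : q ∣ N) (hcop : q.Coprime (N / q)) (hq2 : 2 < q) {d : ℕ} (hd : d ∣ q)
    (hprim : ∀ χ : DirichletCharacter ℂ q, ¬ χ.FactorsThrough d → χ.IsPrimitive)
    (T : ZMod N → ℂ)
    (hT : ∀ χ : DirichletCharacter ℂ N, χ.Odd → χ.IsPrimitive → ∑ x : ZMod N, T x * χ x = 0)
    (a₀ u : (ZMod q)ˣ) (hu : ZMod.unitsMap hd u = 1)
    (hfree : ∀ x : ZMod N, T x ≠ 0 → ZMod.castHom hqN (ZMod q) x ≠ a₀ * u ∧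
      ZMod.castHom hqN (ZMod q) x ≠ -(a₀ * u)) :
    ∀ χ : DirichletCharacter ℂ N, χ.Odd → χ.IsPrimitive →
      ∑ x : ZMod N, (if ZMod.castHom hqN (ZMod q) x = a₀ ∨ ZMod.castHom hqN (ZMod q) x = -a₀ then T x else 0) * χ x = 0 := by
  obtain ⟨n', hn'⟩ := id hqN
  subst hn'
  haveI : NeZero n' := ⟨fun h ↦ (NeZero.ne (q * n')) (by rw [h, mul_zero])⟩
  have hcop' : q.Coprime n' := by rwa [Nat.mul_div_cancel_left _ (NeZero.pos q)] at hcop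
  intro χ hodd hχ
  exact annihilated_restrict_pair hcop' hq2 hd hprim T hT a₀ u hu hfree χ hodd hχ

/-- `exists_free_pair` at a level `N` with `q ∣ N` (prime level `q`; an even primitive character at the
co-level `n₀ = N/q` is supplied by the caller). [cite: Aoki1983, Prop. 6.4 (i)] -/
theorem free_pair_of_dvd (hqN : q ∣ N) (hcop : q.Coprime (N / q)) (hq2 : 2 < q)
    (hprim : ∀ χ : DirichletCharacter ℂ q, ¬ χ.FactorsThrough 1 → χ.IsPrimitive)
    (n₀ : ℕ) (hn₀ : N / q = n₀) (hPC : ∃ χ₂ : DirichletCharacter ℂ n₀, χ₂.Even ∧ χ₂.IsPrimitive)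
    (T : ZMod N → ℂ) (hTu : ∀ x, ¬ IsUnit x → T x = 0)
    (hT : ∀ χ : DirichletCharacter ℂ N, χ.Odd → χ.IsPrimitive → ∑ x : ZMod N, T x * χ x = 0)
    (hcard : #(univ.filter fun x : ZMod N ↦ T x ≠ 0) < #(univ.filter fun a : ZMod q ↦ IsUnit a)) :
    ∃ a₁ : (ZMod q)ˣ, ∀ x : ZMod N, T x ≠ 0 →
      ZMod.castHom hqN (ZMod q) x ≠ a₁ ∧ ZMod.castHom hqN (ZMod q) x ≠ -a₁ := by
  obtain ⟨n', hn'⟩ := id hqN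
  subst hn'
  haveI : NeZero n' := ⟨fun h ↦ (NeZero.ne (q * n')) (by rw [h, mul_zero])⟩
  have hcop' : q.Coprime n' := by rwa [Nat.mul_div_cancel_left _ (NeZero.pos q)] at hcop
  have : n₀ = n' := by rw [← hn₀, Nat.mul_div_cancel_left _ (NeZero.pos q)]
  subst this
  exact exists_free_pair hcop' hq2 hprim hPC T hTu hT hcard

/-- `exists_free_of_card_lt` at a level `N` with `q ∣ N`. [cite: Aoki1983, Prop. 6.4 (ii)] -/
theorem free_of_card_lt_of_dvd (hqN : q ∣ N) {d : ℕ} (hd : d ∣ q) (hm1 : ZMod.unitsMap hd (-1) ≠ 1)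
    (S : Finset (ZMod N)) (a₀ : (ZMod q)ˣ)
    (hcard : #S < #(univ.filter fun u : (ZMod q)ˣ ↦ ZMod.unitsMap hd u = 1)) :
    ∃ u : (ZMod q)ˣ, ZMod.unitsMap hd u = 1 ∧ ∀ x ∈ S,
      ZMod.castHom hqN (ZMod q) x ≠ a₀ * u ∧ ZMod.castHom hqN (ZMod q) x ≠ -(a₀ * u) := by
  obtain ⟨n', hn'⟩ := id hqN
  subst hn'
  exact exists_free_of_card_lt hd hm1 S a₀ hcard

end Transport

section Region

variable {n : ℕ} [NeZero n]

/-- **Local squares**: a unit `u` mod `n` which is `±1` modulo every prime power `pᵛ ∥ n` has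
`u² = 1`. [folklore] -/
theorem sq_eq_one_of_local : ∀ {n : ℕ} [NeZero n] (u : (ZMod n)ˣ), (∀ p ∈ n.primeFactors, ZMod.castHom (Nat.ordProj_dvd n p) (ZMod (p ^ n.factorization p)) (u : ZMod n) = 1 ∨ ZMod.castHom (Nat.ordProj_dvd n p) (ZMod (p ^ n.factorization p)) (u : ZMod n) = -1) → u * u = 1 := by
  intro n _ u h
  have hn0 : n ≠ 0 := NeZero.ne n
  set w : ZMod n := (u : ZMod n) * u - 1 with hw
  have hloc : ∀ p ∈ n.primeFactors, (p ^ n.factorization p) ∣ w.val := by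
    intro p hp
    haveI : NeZero (p ^ n.factorization p) := ⟨pow_ne_zero _ (Nat.prime_of_mem_primeFactors hp).ne_zero⟩
    have hw0 : ZMod.castHom (Nat.ordProj_dvd n p) (ZMod (p ^ n.factorization p)) w = 0 := by
      rw [hw, map_sub, map_mul, map_one]
      rcases h p hp with h1 | h1 <;> rw [h1] <;> ring
    rw [ZMod.castHom_apply, ZMod.cast_eq_val, ZMod.natCast_eq_zero_iff] at hw0
    exact hw0
  have hdvd : n ∣ w.val := by
    rw [Nat.dvd_iff_prime_pow_dvd_dvd]
    intro p k hp hpk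
    rcases Nat.eq_zero_or_pos k with rfl | hk
    · simp
    have hpn : p ∣ n := dvd_trans (dvd_pow_self p hk.ne') hpk
    have hpmem : p ∈ n.primeFactors := Nat.mem_primeFactors.mpr ⟨hp, hpn, hn0⟩
    exact dvd_trans (pow_dvd_pow p ((Nat.Prime.pow_dvd_iff_le_factorization hp hn0).mp hpk)) (hloc p hpmem)
  have hwz : w = 0 := by
    have hlt := ZMod.val_lt w
    have : w.val = 0 := Nat.eq_zero_of_dvd_of_lt hdvd hlt
    exact (ZMod.val_eq_zero w).mp this
  apply Units.ext
  rw [Units.val_mul, Units.val_one]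
  exact sub_eq_zero.mp hwz

omit [NeZero n] in
/-- Reduction to a prime power of `n` factors through reduction mod `n`. [folklore] -/
theorem castHom_primePow_comp {N : ℕ} (hnN : n ∣ N) (p : ℕ) (z : ZMod N) :
    ZMod.castHom ((Nat.ordProj_dvd n p).trans hnN) (ZMod (p ^ n.factorization p)) z =
      ZMod.castHom (Nat.ordProj_dvd n p) (ZMod (p ^ n.factorization p)) (ZMod.castHom hnN (ZMod n) z) := by
  rw [← RingHom.comp_apply, ZMod.castHom_comp]

/-- **The region mod `n` is a sign orbit.** If the unit `z` is `≡ ±x` modulo every prime power of `n`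
(`x` a unit), then `z mod n = u · (x mod n)` with `u² = 1`. [folklore] -/
theorem exists_sq_eq_one_of_region {N : ℕ} [NeZero N] (hnN : n ∣ N) {x z : ZMod N} (hx : IsUnit x)
    (hz : IsUnit z)
    (hreg : ∀ p ∈ n.primeFactors,
      ZMod.castHom ((Nat.ordProj_dvd n p).trans hnN) (ZMod (p ^ n.factorization p)) z =
        ZMod.castHom ((Nat.ordProj_dvd n p).trans hnN) (ZMod (p ^ n.factorization p)) x ∨
      ZMod.castHom ((Nat.ordProj_dvd n p).trans hnN) (ZMod (p ^ n.factorization p)) z =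
        -ZMod.castHom ((Nat.ordProj_dvd n p).trans hnN) (ZMod (p ^ n.factorization p)) x) :
    ∃ u : (ZMod n)ˣ, u * u = 1 ∧
      ZMod.castHom hnN (ZMod n) z = (u : ZMod n) * (hx.map (ZMod.castHom hnN (ZMod n))).unit := by
  set xu := (hx.map (ZMod.castHom hnN (ZMod n))).unit with hxu
  set zu := (hz.map (ZMod.castHom hnN (ZMod n))).unit with hzu
  refine ⟨zu * xu⁻¹, ?_, ?_⟩
  · apply sq_eq_one_of_local
    intro p hp
    haveI : NeZero (p ^ n.factorization p) := ⟨pow_ne_zero _ (Nat.prime_of_mem_primeFactors hp).ne_zero⟩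
    have hxp : IsUnit (ZMod.castHom (Nat.ordProj_dvd n p) (ZMod (p ^ n.factorization p)) (xu : ZMod n)) :=
      (Units.isUnit xu).map _
    have key : ZMod.castHom (Nat.ordProj_dvd n p) (ZMod (p ^ n.factorization p)) (zu : ZMod n) =
        ZMod.castHom (Nat.ordProj_dvd n p) (ZMod (p ^ n.factorization p)) (xu : ZMod n) ∨
        ZMod.castHom (Nat.ordProj_dvd n p) (ZMod (p ^ n.factorization p)) (zu : ZMod n) =
        -ZMod.castHom (Nat.ordProj_dvd n p) (ZMod (p ^ n.factorization p)) (xu : ZMod n) := by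
      have h1 : (zu : ZMod n) = ZMod.castHom hnN (ZMod n) z := IsUnit.unit_spec _
      have h2 : (xu : ZMod n) = ZMod.castHom hnN (ZMod n) x := IsUnit.unit_spec _
      rw [h1, h2, ← castHom_primePow_comp hnN p z, ← castHom_primePow_comp hnN p x]
      exact hreg p hp
    rw [Units.val_mul, map_mul]
    have hinv : ZMod.castHom (Nat.ordProj_dvd n p) (ZMod (p ^ n.factorization p)) ((xu⁻¹ : (ZMod n)ˣ) : ZMod n) *
        ZMod.castHom (Nat.ordProj_dvd n p) (ZMod (p ^ n.factorization p)) (xu : ZMod n) = 1 := by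
      rw [← map_mul, Units.inv_mul, map_one]
    rcases key with hk | hk
    · left
      rw [hk]
      rw [mul_comm] at hinv
      exact hinv
    · right
      rw [hk, neg_mul, mul_comm, hinv]
  · rw [Units.val_mul, mul_assoc, Units.inv_mul, mul_one]
    exact (IsUnit.unit_spec _).symm

end Region

section Pieces

variable {p₀ n : ℕ} [NeZero p₀] [NeZero n]

/-- `πq[p']` — reduction from level `p₀ · n` to the prime power `p' ^ v_{p'}(n)` of `n`. Local notation. -/
local notation3 (prettyPrint := false) "πq[" p' "]" =>
  ZMod.castHom ((Nat.ordProj_dvd n p').trans (dvd_mul_left n p₀)) (ZMod (p' ^ n.factorization p'))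

/-- `Reg[P, x, z]` — `z` lies in the region of `x` at the primes of `P`: `z ≡ ±x` modulo `p' ^ v_{p'}(n)`
for every `p' ∈ P`. Local notation. -/
local notation3 (prettyPrint := false) "Reg[" P ", " x ", " z "]" =>
  ∀ p' ∈ (P : Finset ℕ), πq[p'] z = πq[p'] x ∨ πq[p'] z = -(πq[p'] x)

/-- **Iterated pair restriction.** Let `p₀` be a prime `≥ 5` not dividing `n`, all primes of `n` `≥ 5`,
and let `T : ℤ/(p₀ n) → ℂ` be supported on units, annihilated by every odd primitive character, with
`#supp T + 1 < p'` for every prime `p' ∣ n`. Then for every unit `x` and every set `P` of primes of `n`,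
the restriction of `T` to the region `{z : z ≡ ±x (mod p'^{v_{p'}(n)}) ∀ p' ∈ P}` is again annihilated
by every odd primitive character mod `p₀ n`. [cite: Aoki1983, Prop. 6.4] -/
theorem piece_annihilated (hp₀ : p₀.Prime) (hp₀5 : 5 ≤ p₀) (hp₀n : ¬ p₀ ∣ n)
    (hn5 : ∀ p' ∈ n.primeFactors, 5 ≤ p')
    (T : ZMod (p₀ * n) → ℂ) (hTu : ∀ z, ¬ IsUnit z → T z = 0)
    (hT : ∀ χ : DirichletCharacter ℂ (p₀ * n), χ.Odd → χ.IsPrimitive → ∑ z : ZMod (p₀ * n), T z * χ z = 0)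
    (hroom : ∀ p' ∈ n.primeFactors, #(univ.filter fun z : ZMod (p₀ * n) ↦ T z ≠ 0) + 1 < p')
    {x : ZMod (p₀ * n)} (hx : IsUnit x) :
    ∀ P : Finset ℕ, P ⊆ n.primeFactors →
      ∀ χ : DirichletCharacter ℂ (p₀ * n), χ.Odd → χ.IsPrimitive →
        ∑ z : ZMod (p₀ * n), (if Reg[P, x, z] then T z else 0) * χ z = 0 := by
  classical
  have hn0 : n ≠ 0 := NeZero.ne n
  have hN0 : p₀ * n ≠ 0 := NeZero.ne _
  have hp₀2 : p₀ ≠ 2 := by omega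
  have hp₀odd : Odd p₀ := hp₀.odd_of_ne_two hp₀2
  have hnodd : Odd n := by
    rw [Nat.odd_iff]
    by_contra h2
    have h2n : 2 ∣ n := Nat.dvd_of_mod_eq_zero (by omega)
    have := hn5 2 (Nat.mem_primeFactors.mpr ⟨Nat.prime_two, h2n, hn0⟩)
    omega
  intro P
  induction P using Finset.induction_on with
  | empty =>
    intro _ χ hχo hχp
    have hall : ∀ z : ZMod (p₀ * n), (if Reg[(∅ : Finset ℕ), x, z] then T z else 0) = T z :=
      fun z ↦ if_pos (fun p' hp' ↦ absurd hp' (Finset.notMem_empty p'))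
    simp_rw [hall]
    exact hT χ hχo hχp
  | insert p' P hp'P ih =>
    intro hsub χ hχo hχp
    have hp'mem : p' ∈ n.primeFactors := hsub (mem_insert_self _ _)
    have hPsub : P ⊆ n.primeFactors := (subset_insert _ _).trans hsub
    have ihT := ih hPsub
    set TP : ZMod (p₀ * n) → ℂ := fun z ↦ if Reg[P, x, z] then T z else 0 with hTP
    have hTPu : ∀ z, ¬ IsUnit z → TP z = 0 := by
      intro z hz; simp only [hTP]; split_ifs <;> simp [hTu z hz]
    have hTPle : #(univ.filter fun z : ZMod (p₀ * n) ↦ TP z ≠ 0) ≤ #(univ.filter fun z : ZMod (p₀ * n) ↦ T z ≠ 0) := by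
      refine card_le_card fun z hz ↦ ?_
      rw [mem_filter] at hz ⊢
      refine ⟨mem_univ _, fun h0 ↦ hz.2 ?_⟩
      simp only [hTP, h0, ite_self]
    -- the prime power `q = p'^e ∥ n`
    have hp' : p'.Prime := Nat.prime_of_mem_primeFactors hp'mem
    have hp'5 : 5 ≤ p' := hn5 p' hp'mem
    set e := n.factorization p' with he
    have he1 : 1 ≤ e := Nat.Prime.factorization_pos_of_dvd hp' hn0 (Nat.dvd_of_mem_primeFactors hp'mem)
    haveI : NeZero (p' ^ e) := ⟨pow_ne_zero _ hp'.ne_zero⟩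
    have hqn : p' ^ e ∣ n := Nat.ordProj_dvd n p'
    have hqN : p' ^ e ∣ p₀ * n := hqn.trans (dvd_mul_left n p₀)
    have hp'p₀ : p' ≠ p₀ := fun h ↦ hp₀n (h ▸ Nat.dvd_of_mem_primeFactors hp'mem)
    have hdiv : p₀ * n / p' ^ e = p₀ * (n / p' ^ e) := Nat.mul_div_assoc p₀ hqn
    have hcop : (p' ^ e).Coprime (p₀ * n / p' ^ e) := by
      rw [hdiv]
      refine Nat.Coprime.mul_right (Nat.Coprime.pow_left _ ((Nat.coprime_primes hp' hp₀).mpr hp'p₀)) ?_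
      exact Nat.Coprime.pow_left _ (Nat.coprime_ordCompl hp' hn0)
    have hq5 : 5 ≤ p' ^ e := le_trans hp'5 (Nat.le_self_pow (by omega) p')
    have hq2 : 2 < p' ^ e := by omega
    -- the co-level `p₀ · (n / p'^e)`: odd, `≥ 5`
    haveI : NeZero (n / p' ^ e) := ⟨fun h0 ↦ by
      have := Nat.div_mul_cancel hqn
      rw [h0, zero_mul] at this
      exact hn0 this.symm⟩
    have hco_odd : Odd (p₀ * (n / p' ^ e)) := hp₀odd.mul (hnodd.of_dvd_nat (Nat.div_dvd_of_dvd hqn))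
    have hco5 : 5 ≤ p₀ * (n / p' ^ e) := le_trans hp₀5 (Nat.le_mul_of_pos_right _ (NeZero.pos _))
    haveI : NeZero (p₀ * (n / p' ^ e)) := ⟨by omega⟩
    set a₀ : (ZMod (p' ^ e))ˣ := (hx.map (πq[p'])).unit with ha₀
    have ha₀v : (a₀ : ZMod (p' ^ e)) = πq[p'] x := IsUnit.unit_spec _
    -- a free element and the restriction
    have hrestr : ∃ (d : ℕ) (hd : d ∣ p' ^ e) (u : (ZMod (p' ^ e))ˣ),
        (∀ χ' : DirichletCharacter ℂ (p' ^ e), ¬ χ'.FactorsThrough d → χ'.IsPrimitive) ∧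
        ZMod.unitsMap hd u = 1 ∧
        ∀ z, TP z ≠ 0 → πq[p'] z ≠ a₀ * u ∧ πq[p'] z ≠ -(a₀ * u) := by
      rcases Nat.lt_or_ge e 2 with he2 | he2
      · have he1' : e = 1 := by omega
        have hprim1 : ∀ χ' : DirichletCharacter ℂ (p' ^ e), ¬ χ'.FactorsThrough 1 → χ'.IsPrimitive := by
          rw [he1', pow_one]; exact fun χ' h ↦ isPrimitive_of_not_factorsThrough_one_prime hp' χ' h
        have hPC : ∃ χ₂ : DirichletCharacter ℂ (p₀ * (n / p' ^ e)), χ₂.Even ∧ χ₂.IsPrimitive :=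
          exists_even_isPrimitive (Or.inl hco_odd) (by omega) (by omega)
        have hcardq : #(univ.filter fun z : ZMod (p₀ * n) ↦ TP z ≠ 0) <
            #(univ.filter fun a : ZMod (p' ^ e) ↦ IsUnit a) := by
          have hunits : #(univ.filter fun a : ZMod (p' ^ e) ↦ IsUnit a) = (p' ^ e).totient := card_filter_isUnit
          have htot : (p' ^ e).totient = p' - 1 := by rw [he1', pow_one, Nat.totient_prime hp']
          rw [hunits, htot]
          have := hroom p' hp'mem
          omega
        obtain ⟨a₁, ha₁⟩ := free_pair_of_dvd hqN hcop hq2 hprim1 (p₀ * (n / p' ^ e)) hdiv hPC TP hTPu ihT hcardq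
        refine ⟨1, one_dvd _, a₀⁻¹ * a₁, hprim1, Subsingleton.elim _ _, fun z hz ↦ ?_⟩
        rw [Units.val_mul, ← mul_assoc, Units.mul_inv, one_mul]
        exact ha₁ z hz
      · have hd : p' ^ (e - 1) ∣ p' ^ e := pow_dvd_pow p' (Nat.sub_le e 1)
        have hm1 : ZMod.unitsMap hd (-1 : (ZMod (p' ^ e))ˣ) ≠ 1 := by
          refine unitsMap_neg_one_ne_one hd ?_
          calc 2 < 5 := by norm_num
            _ ≤ p' := hp'5
            _ ≤ p' ^ (e - 1) := Nat.le_self_pow (by omega) p'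
        have hcardK : #(univ.filter fun z : ZMod (p₀ * n) ↦ TP z ≠ 0) <
            #(univ.filter fun u : (ZMod (p' ^ e))ˣ ↦ ZMod.unitsMap hd u = 1) := by
          rw [card_ker_primePow hp' he2]
          have := hroom p' hp'mem
          omega
        obtain ⟨u, hu, hfreeS⟩ := free_of_card_lt_of_dvd hqN hd hm1 _ a₀ hcardK
        refine ⟨p' ^ (e - 1), hd, u, fun χ' h ↦ isPrimitive_of_not_factorsThrough_primePow hp' he1 χ' h, hu,
          fun z hz ↦ hfreeS z ?_⟩
        rw [mem_filter]; exact ⟨mem_univ _, hz⟩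
    obtain ⟨d, hd, u, hprim, hu, hfree⟩ := hrestr
    have key := restrict_pair_of_dvd hqN hcop hq2 hd hprim TP ihT a₀ u hu hfree χ hχo hχp
    refine Eq.trans (Finset.sum_congr rfl fun z _ ↦ ?_) key
    -- the piece over `insert p' P` is the restriction of the piece over `P`
    congr 1
    have hreg_iff : Reg[insert p' P, x, z] ↔ ((πq[p'] z = πq[p'] x ∨ πq[p'] z = -(πq[p'] x)) ∧ Reg[P, x, z]) :=
      Finset.forall_mem_insert p' P _
    by_cases h1 : ZMod.castHom hqN (ZMod (p' ^ e)) z = a₀ ∨ ZMod.castHom hqN (ZMod (p' ^ e)) z = -a₀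
    · have h1' : πq[p'] z = πq[p'] x ∨ πq[p'] z = -(πq[p'] x) := by rw [← ha₀v]; exact h1
      rw [if_pos h1]
      by_cases h2 : Reg[P, x, z]
      · rw [if_pos (hreg_iff.mpr ⟨h1', h2⟩)]; simp only [hTP, if_pos h2]
      · rw [if_neg (fun h ↦ h2 (hreg_iff.mp h).2)]; simp only [hTP, if_neg h2]
    · have h1' : ¬ (πq[p'] z = πq[p'] x ∨ πq[p'] z = -(πq[p'] x)) := by rw [← ha₀v]; exact h1
      rw [if_neg h1, if_neg (fun h ↦ h1' (hreg_iff.mp h).1)]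

/-! ### Fibre constancy at `p₀` -/

/-- **Fibre constancy.** Let `Tp : ℤ/(p₀ n) → ℂ` (`p₀` prime, `p₀ ∤ n`, all primes of `n` `≥ 5`) be
annihilated by every odd primitive character and supported on units lying in the region of a unit `x`
at ALL primes of `n`. Then on every fibre `{crt⁻¹(y, b) : y}` the function `z ↦ Tp(z) - Tp(-z)` is
constant in the unit `y` mod `p₀`. (For a non-trivial `χ₁` mod `p₀`, `b ↦ ∑_y Tp(crt⁻¹(y,b)) χ₁(y)` is
supported on the sign orbit of `x mod n` and orthogonal to the primitive characters of parity
`-χ₁(-1)`, so `orbit_sign` relates its values at `±b`; hence `y ↦ Tp(crt⁻¹(y,b)) - Tp(-crt⁻¹(y,b))` is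
orthogonal to every non-trivial character mod `p₀`.) [cite: Aoki1983, §9] -/
theorem fibre_const_of_piece (hp₀ : p₀.Prime) (hc : p₀.Coprime n) (hn5 : ∀ p' ∈ n.primeFactors, 5 ≤ p')
    (Tp : ZMod (p₀ * n) → ℂ)
    (hTp : ∀ χ : DirichletCharacter ℂ (p₀ * n), χ.Odd → χ.IsPrimitive → ∑ z : ZMod (p₀ * n), Tp z * χ z = 0)
    {x : ZMod (p₀ * n)} (hx : IsUnit x)
    (hsupp : ∀ z, Tp z ≠ 0 → IsUnit z ∧ Reg[n.primeFactors, x, z])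
    (b : ZMod n) (y : (ZMod p₀)ˣ) :
    Tp ((ZMod.chineseRemainder hc).symm (y, b)) - Tp (-(ZMod.chineseRemainder hc).symm (y, b)) =
      Tp ((ZMod.chineseRemainder hc).symm (1, b)) - Tp (-(ZMod.chineseRemainder hc).symm (1, b)) := by
  classical
  set D : ZMod p₀ → ℂ := fun a ↦ Tp ((ZMod.chineseRemainder hc).symm (a, b)) -
    Tp (-(ZMod.chineseRemainder hc).symm (a, b)) with hD
  set A : (ZMod n)ˣ := (hx.map (ZMod.castHom (dvd_mul_left n p₀) (ZMod n))).unit with hA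
  -- every non-trivial character mod `p₀` kills `D`
  have hclaim : ∀ χ₁ : DirichletCharacter ℂ p₀, ¬ χ₁.FactorsThrough 1 → ∑ a : ZMod p₀, D a * χ₁ a = 0 := by
    intro χ₁ hχ₁
    have hχ₁p : χ₁.IsPrimitive := isPrimitive_of_not_factorsThrough_one_prime hp₀ χ₁ hχ₁
    set σ : ℂ := χ₁ (-1) with hσ
    have hσsq : σ * σ = 1 := by rw [hσ, ← map_mul, neg_one_mul, neg_neg, map_one]
    have hσpm : σ = 1 ∨ σ = -1 := char_neg_one_eq_or χ₁
    set H : ZMod n → ℂ := fun b' ↦ ∑ a : ZMod p₀, Tp ((ZMod.chineseRemainder hc).symm (a, b')) * χ₁ a with hH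
    -- (i) support of `H` on the sign orbit of `A`
    have hHsupp : ∀ b', H b' ≠ 0 → ∃ u : (ZMod n)ˣ, u * u = 1 ∧ b' = (u : ZMod n) * A := by
      intro b' hb'
      obtain ⟨a, -, ha⟩ := Finset.exists_ne_zero_of_sum_ne_zero hb'
      have hz : Tp ((ZMod.chineseRemainder hc).symm (a, b')) ≠ 0 := fun h0 ↦ ha (by rw [h0, zero_mul])
      obtain ⟨hzu, hreg⟩ := hsupp _ hz
      obtain ⟨u, hu, hub⟩ := exists_sq_eq_one_of_region (dvd_mul_left n p₀) hx hzu hreg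
      refine ⟨u, hu, ?_⟩
      rw [(castHom_crt_symm hc a b').2] at hub
      exact hub
    -- (ii) `H` is orthogonal to the primitive characters of parity `-σ`
    have hHnull : ∀ χ₂ : DirichletCharacter ℂ n, χ₂.IsPrimitive → χ₂ (-1) = -σ →
        ∑ b' : ZMod n, H b' * χ₂ b' = 0 := by
      intro χ₂ hχ₂ hpar
      have hprim := prodChar_isPrimitive hc hχ₁p hχ₂
      have hodd : (DirichletCharacter.changeLevel (dvd_mul_right p₀ n) χ₁ *
          DirichletCharacter.changeLevel (dvd_mul_left n p₀) χ₂).Odd := by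
        rw [DirichletCharacter.Odd, prodChar_neg_one, hpar, ← hσ]
        linear_combination (-1 : ℂ) * hσsq
      have key := hTp _ hodd hprim
      rw [sum_mul_prodChar_eq hc] at key
      simp_rw [Finset.mul_sum] at key
      rw [Finset.sum_comm] at key
      rw [← key]
      refine Finset.sum_congr rfl fun b' _ ↦ ?_
      rw [hH, Finset.sum_mul]
      exact Finset.sum_congr rfl fun a _ ↦ by ring
    -- (iii) the sign-orbit lemma
    have hτ : (-σ = 1 ∨ -σ = -1) := by rcases hσpm with h | h <;> rw [h] <;> norm_num
    have horbit := orbit_sign n hn5 (-σ) hτ H A hHsupp hHnull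
    -- (iv) `∑ D χ₁ = H b - σ H(-b) = 0`
    have hneg : ∑ a : ZMod p₀, Tp (-(ZMod.chineseRemainder hc).symm (a, b)) * χ₁ a = σ * H (-b) := by
      rw [hH, Finset.mul_sum, ← Equiv.sum_comp (Equiv.neg (ZMod p₀))]
      refine Finset.sum_congr rfl fun a _ ↦ ?_
      rw [Equiv.neg_apply, ← crt_symm_neg, neg_neg,
        show χ₁ (-a) = χ₁ (-1) * χ₁ a by rw [← map_mul, neg_one_mul], ← hσ]
      ring
    have hsplit : ∑ a : ZMod p₀, D a * χ₁ a = H b - ∑ a : ZMod p₀, Tp (-(ZMod.chineseRemainder hc).symm (a, b)) * χ₁ a := by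
      rw [hH, ← Finset.sum_sub_distrib]
      exact Finset.sum_congr rfl fun a _ ↦ by rw [hD]; ring
    rw [hsplit, hneg, horbit b]
    linear_combination (-(H b)) * hσsq
  -- local Fourier lemma with `d = 1`: `D` is constant on units
  have h1 := parityPart_mul_eq_of_orthogonal (one_dvd p₀) D (Or.inl rfl)
    (fun χ₁ _ hχ₁ ↦ hclaim χ₁ hχ₁) y 1 (Subsingleton.elim (α := (ZMod 1)ˣ) _ _)
  have h2 := parityPart_mul_eq_of_orthogonal (one_dvd p₀) D (Or.inr rfl)
    (fun χ₁ _ hχ₁ ↦ hclaim χ₁ hχ₁) y 1 (Subsingleton.elim (α := (ZMod 1)ˣ) _ _)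
  simp only [Units.val_one, mul_one] at h1 h2
  have h3 : (2 : ℂ) * D y = 2 * D 1 := by linear_combination h1 + h2
  have h4 := mul_left_cancel₀ (two_ne_zero (α := ℂ)) h3
  simpa only [hD] using h4

end Pieces

end PairedNull

end Summit.HodgeConjecture.HodgeConjecture.Theorems.CancelByAnyClaimLattice

end
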